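import Mathlib
import Literature.Computability.Complexity.IndexAllBricks
import Literature.Computability.Complexity.UnaryBricks
import Literature.Computability.Complexity.HashBricks
import Literature.Computability.Complexity.PlumbingBricks
import Literature.Computability.Complexity.LengthCompare
import Literature.Computability.Complexity.NondeterministicProofs
import Literature.Computability.MetaComplexity.ChenJinSanthanamWilliams2022.StreamingRefuterMagnification
import HarnessLib

/-!
# `DISJ ∈ P` (hence `∈ NP`) for the stream language of Chen–Jin–Santhanam–Williams Thms. 1.3/1.4

Support file for census rows R36/R65 (`MagnificationGapCensus/StreamingRefuters.lean`,
`…/PNPStreamingRefuters.lean`). CJSW Thm. 1.3 (`PNPStreamingRefuterMagnification.thm13`) quantifies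
over `L ∈ NP`; the census pairs it with Thm. 1.4's language `DISJ` (fact file
`StreamingRefuterMagnification.lean`: `w ∈ DISJ` iff some index `i < ⌊|w|/2⌋` has
`w[i] = w[⌊|w|/2⌋ + i] = 1`). This file PROVES `DISJ ∈ P` in the tree's machine model by brick
assembly (no machine is programmed): the indicator `w ↦ [disjAnswer w]` is the negation of the
index-all loop `Brick.allIdxFn` (yardstick `halfFn`, `⌊|w|/2⌋` rounds) of the one-bit test
"NOT (bit `i` AND bit `⌊|w|/2⌋ + i`)", each bit read by `headBitFn ∘ dropFn`; `P ⊆ NP`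
(`P_subset_NP_holds`) then gives `DISJ ∈ NP`, the membership side condition of Thm. 1.3 at
`L = DISJ`. HONEST FRAMING: routine closure bookkeeping [Arora–Barak 2009, §1.3: polynomial time is
closed under composition and bounded loops]; nothing here is an approach to the summit.
-/

noncomputable section

namespace Literature.Computability.MetaComplexity.ChenJinSanthanamWilliams2022

open _root_.Computability
open Literature.Computability.Complexity Literature.Computability.Complexity.Brick
open Literature.Computability.Complexity.Nondeterministic

/-- Bit `|a|` of `u`, read from the pair `⟨u, a⟩`: `[u.getD |a| false]` (head of `u ⇂ |a|`).
[folklore] -/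
def bitLo : List Bool → List Bool :=
  HashBricks.headBitFn ∘ Plumb.dropFn ∘ fanoutFn sndF fstF

/-- Bit `⌊|u|/2⌋ + |a|` of `u`, read from the pair `⟨u, a⟩`. [folklore] -/
def bitHi : List Bool → List Bool :=
  HashBricks.headBitFn ∘ Plumb.dropFn ∘ fanoutFn (OracleCompose.concatFn ∘ fanoutFn (halfFn ∘ fstF) sndF) fstF

/-- The one-bit round test `⟨u, a⟩ ↦ [¬ (u[|a|] ∧ u[⌊|u|/2⌋ + |a|])]`. [folklore] -/
def roundTest : List Bool → List Bool :=
  notFn (andFn bitLo bitHi)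

/-- The indicator of `DISJ` as a string function: NOT (every round test passes). [folklore] -/
def disjIndFn : List Bool → List Bool :=
  notFn (allIdxFn halfFn roundTest)

/-- Value of `bitLo` on a pair. [folklore] -/
@[simp] theorem bitLo_boolPair (u a : List Bool) : bitLo (boolPair u a) = [u.getD a.length false] := by
  simp [bitLo, List.getD_eq_getElem?_getD]

/-- Value of `bitHi` on a pair. [folklore] -/
@[simp] theorem bitHi_boolPair (u a : List Bool) :
    bitHi (boolPair u a) = [u.getD (u.length / 2 + a.length) false] := by
  simp [bitHi, halfFn, ones, List.getD_eq_getElem?_getD]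

/-- `bitLo` is one-bit. [folklore] -/
theorem oneBit_bitLo : OneBit bitLo := fun z => by
  simp only [bitLo, Function.comp_apply]
  exact ⟨_, HashBricks.headBitFn_apply _⟩

/-- `bitHi` is one-bit. [folklore] -/
theorem oneBit_bitHi : OneBit bitHi := fun z => by
  simp only [bitHi, Function.comp_apply]
  exact ⟨_, HashBricks.headBitFn_apply _⟩

/-- Value of the round test on a pair. [folklore] -/
theorem roundTest_boolPair (u a : List Bool) :
    roundTest (boolPair u a) = [!(u.getD a.length false && u.getD (u.length / 2 + a.length) false)] := by
  rw [roundTest, notFn_apply (andFn_apply (bitLo_boolPair u a) (bitHi_boolPair u a))]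

/-- The round test is one-bit. [folklore] -/
theorem oneBit_roundTest : OneBit roundTest := fun z => by
  obtain ⟨b, hb⟩ := oneBit_bitLo z
  obtain ⟨b', hb'⟩ := oneBit_bitHi z
  exact ⟨_, by rw [roundTest, notFn_apply (andFn_apply hb hb')]⟩

/-- `bitLo ∈ FP`. [cite: AroraBarakCC2009, §1.3 (composition)] -/
theorem bitLo_mem_FP : bitLo ∈ FP :=
  comp_mem_FP HashBricks.headBitFn_mem_FP (comp_mem_FP Plumb.dropFn_mem_FP (fanoutFn_mem_FP sndF_mem_FP fstF_mem_FP))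

/-- `bitHi ∈ FP`. [cite: AroraBarakCC2009, §1.3 (composition)] -/
theorem bitHi_mem_FP : bitHi ∈ FP :=
  comp_mem_FP HashBricks.headBitFn_mem_FP (comp_mem_FP Plumb.dropFn_mem_FP
    (fanoutFn_mem_FP (comp_mem_FP OracleCompose.concatFn_mem_FP
      (fanoutFn_mem_FP (comp_mem_FP halfFn_mem_FP fstF_mem_FP) sndF_mem_FP)) fstF_mem_FP))

/-- `roundTest ∈ FP`. [cite: AroraBarakCC2009, §1.3 (composition)] -/
theorem roundTest_mem_FP : roundTest ∈ FP := notFn_mem_FP (andFn_mem_FP bitLo_mem_FP bitHi_mem_FP)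

/-- `disjIndFn ∈ FP` (a bounded loop of `⌊|w|/2⌋` one-bit rounds). [cite: AroraBarakCC2009, §1.3 (bounded loops)] -/
theorem disjFn_mem_FP : disjIndFn ∈ FP :=
  notFn_mem_FP (allIdxFn_mem_FP halfFn_mem_FP roundTest_mem_FP oneBit_roundTest)

/-- **`disjIndFn w = [disjAnswer w]`**: the brick function is the indicator of `DISJ`. [folklore] -/
theorem disjFn_apply (w : List Bool) : disjIndFn w = [disjAnswer w] := by
  have hy : (halfFn w).length ≤ w.length := by rw [length_halfFn]; omega
  rw [disjIndFn, notFn_apply (allIdxFn_apply oneBit_roundTest hy), length_halfFn]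
  simp only [roundTest_boolPair, ones, List.length_replicate, List.cons.injEq, and_true]
  rw [Bool.eq_iff_iff]
  simp [disjAnswer]

/-- **`DISJ ∈ P`.** [cite: AroraBarakCC2009, §1.3 (bounded loops)] -/
theorem DISJ_mem_P : DISJ ∈ Classes.P :=
  mem_P_of_mem_FP disjFn_mem_FP DISJ fun w =>
    ⟨fun hw => by rw [disjFn_apply, show disjAnswer w = true from hw],
     fun hw => by rw [disjFn_apply, Bool.eq_false_iff.mpr hw]⟩

/-- **`DISJ ∈ NP`** — the membership side condition of CJSW Thm. 1.3 at `L = DISJ`.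
[cite: AroraBarak2009, Claim 2.4] -/
theorem DISJ_mem_NP : DISJ ∈ NP := P_subset_NP_holds DISJ_mem_P

end Literature.Computability.MetaComplexity.ChenJinSanthanamWilliams2022

end
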